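import Summits.CriticalPhenomena.PercolationContinuityZ3.Theorems.Transplant.FKConnectivityAllQAntipodalTwoSpineResolve
import HarnessLib

/-!
# Two-spine word model of `U¹¹` — the MODE INDUCTION: a checked closure certificate proves every statement of its family for
# all pairs of spine shapes, given the base cases

Theorem file (`--supports stmt-CriticalPhenomena-4575`), FK sub-lane `prim-bschramm-fk-2` (gen 15); builds on p205010 (kernel
theorem, internal audit signed; external expert review pending).  No named facts, no sorries.

A CLOSURE CERTIFICATE (`FK.TwoSpine.Cert`) is a finite family of diagrams together with, for every member `D` and every op kind
`k`, a resolution of the peeled diagrams `D.peelA k` and `D.peelB k` into members of the family (pieces referred to by index).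
`Cert.check` verifies all resolutions (`FK.TwoSpine.Resolution.checkL`: the check of `…TwoSpineResolve` with reachability computed by an explicit
list closure, so that the kernel evaluates it in polynomial time).  **`FK.TwoSpine.Cert.sound`**: if the check passes, `0 ≤ q`,
and every member's statement holds for the empty shapes (the BASE CASES `DStmt q top D [] []`, i.e. for `A = {y}`, `B = {z}`), then
every member's statement holds for EVERY pair of shapes — by induction on the shapes, peeling the outermost part (`DStmt.of_peelA/B`)
and resolving (`DStmt.of_resolution`).  This is the engine of memo g15 §6: with the member `(o,o,o,o)` it yields the two-spine
word inequality behind `U¹¹(A ∘ B) ≥ 0` for all spine shapes at once.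
[cite: Grimmett2006, §3.8 (pp. 61–62)]
-/

noncomputable section

namespace Summit.CriticalPhenomena.PercolationContinuityZ3.Theorems

namespace FK

namespace TwoSpine

open X2Word


/-! ### Reachability by an explicit list closure (kernel-evaluable in polynomial time) -/

/-- `reachList le n S`: `n` rounds of adding the heads of all constraints whose tail is already listed. [folklore] -/
def reachList (le : List (ℕ × ℕ)) : ℕ → List ℕ → List ℕ
  | 0, S => S
  | n + 1, S => reachList le n (S ++ (le.filter fun p => decide (p.1 ∈ S)).map Prod.snd)

/-- `reachableL le n i j`: `j` is listed after `n` rounds from `[i]` (a computable reachability test). [folklore] -/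
def reachableL (le : List (ℕ × ℕ)) (n i j : ℕ) : Bool := decide (j ∈ reachList le n [i])

/-- An admissible family is monotone along `reachableL`. [folklore] -/
theorem Admissible.le_of_reachL {D : Diagram} {S : ℕ → List SLetter → List SLetter → ℝ} (hS : Admissible D S)
    (n i j : ℕ) (h : reachableL D.le n i j = true) (u v : List SLetter) : S i u v ≤ S j u v := by
  unfold reachableL at h
  rw [decide_eq_true_eq] at h
  suffices key : ∀ (n : ℕ) (S₀ : List ℕ), (∀ x ∈ S₀, S i u v ≤ S x u v) → ∀ x ∈ reachList D.le n S₀, S i u v ≤ S x u v from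
    key n [i] (fun x hx => by rw [List.mem_singleton.1 hx]) j h
  intro n
  induction n with
  | zero => intro S₀ h0 x hx; exact h0 x hx
  | succ n ih =>
    intro S₀ h0 x hx
    refine ih _ (fun y hy => ?_) x hx
    rw [List.mem_append] at hy
    rcases hy with hy | hy
    · exact h0 y hy
    · rw [List.mem_map] at hy
      obtain ⟨p, hp, rfl⟩ := hy
      rw [List.mem_filter, decide_eq_true_eq] at hp
      exact (h0 _ hp.2).trans (hS.le p hp.1 u v)

/-- The decidable CHECK of a resolution, with the list-closure reachability test (same conditions as `Resolution.check`). [folklore] -/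
def Resolution.checkL (D : Diagram) (pieces : List Piece) : Bool :=
  decide ((pieces.flatMap fun pc => pc.f).Perm (List.range D.nodes.length)) &&
  pieces.all fun pc =>
    decide (pc.f.length = pc.P.nodes.length) &&
    (List.range pc.P.nodes.length).all (fun a =>
      decide (D.nodes.getD (pc.f.getD a 0) dfltNode = ((pc.P.nodes.getD a dfltNode).1, (pc.P.nodes.getD a dfltNode).2 + pc.c))) &&
    pc.P.le.all fun ab => reachableL D.le D.le.length (pc.f.getD ab.1 0) (pc.f.getD ab.2 0)

/-- A `D`-admissible family restricts to a `P`-admissible one (list-closure version). [folklore] -/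
theorem Admissible.pieceL {D : Diagram} {S : ℕ → List SLetter → List SLetter → ℝ} (hS : Admissible D S) (pc : Piece)
    (hle : ∀ ab ∈ pc.P.le, reachableL D.le D.le.length (pc.f.getD ab.1 0) (pc.f.getD ab.2 0) = true) :
    Admissible pc.P (famPiece pc S) where
  nonneg _ _ _ := hS.nonneg _ _ _
  monoA _ _ _ _ h := hS.monoA _ _ _ _ h
  monoB _ _ _ _ h := hS.monoB _ _ _ _ h
  le ab hab u v := hS.le_of_reachL _ _ _ (hle ab hab) u v

/-- **RESOLUTION SOUNDNESS** (list-closure version of `DStmt.of_resolution`). [folklore] -/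
theorem DStmt.of_resolutionL {q : ℝ} (hq : 0 ≤ q) {top : Top} {D : Diagram} {pieces : List Piece} (hc : Resolution.checkL D pieces = true)
    {oA oB : List Kind} (hP : ∀ pc ∈ pieces, DStmt q top pc.P oA oB) : DStmt q top D oA oB := by
  intro S hS
  unfold Resolution.checkL at hc
  simp only [Bool.and_eq_true, decide_eq_true_eq, List.all_eq_true, List.mem_range] at hc
  obtain ⟨hperm, hpc⟩ := hc
  rw [dsum_eq_list_sum, ← (hperm.map (nodeTerm q top D oA oB S)).sum_eq, List.map_flatMap, List.flatMap_def, List.sum_flatten,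
    List.map_map]
  refine List.sum_nonneg (fun x hx => ?_)
  rw [List.mem_map] at hx
  obtain ⟨pc, hpc', rfl⟩ := hx
  obtain ⟨⟨hlen, hlab⟩, hle⟩ := hpc pc hpc'
  show 0 ≤ (pc.f.map (nodeTerm q top D oA oB S)).sum
  rw [dsum_piece q top D oA oB S pc hlen hlab]
  exact mul_nonneg (pow_nonneg hq _) (hP pc hpc' _ (hS.pieceL pc hle))

/-- A piece referred to by its INDEX in a family: (family index, node positions, exponent offset). [folklore] -/
abbrev IPiece := ℕ × List ℕ × ℕ

/-- The default (empty) diagram. [folklore] -/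
def dfltDiagram : Diagram := ⟨[], []⟩

/-- Realise an indexed piece against a family. [folklore] -/
def IPiece.toPiece (fam : List Diagram) (ip : IPiece) : Piece := ⟨fam.getD ip.1 dfltDiagram, ip.2.1, ip.2.2⟩

/-- A CLOSURE CERTIFICATE of the mode induction: a family of diagrams and, for each member (by position) and each op kind
(`W` = series part, `P` = parallel part), resolutions of its two peelings into members of the family. [folklore] -/
structure Cert where
  /-- the family of diagram statements proved simultaneously -/
  family : List Diagram
  /-- `resA d k` resolves `(family[d]).peelA k` -/
  resA : ℕ → Kind → List IPiece
  /-- `resB d k` resolves `(family[d]).peelB k` -/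
  resB : ℕ → Kind → List IPiece

/-- The decidable CHECK of a closure certificate: every piece index is in range and every resolution checks. [folklore] -/
def Cert.check (C : Cert) : Bool :=
  (List.range C.family.length).all fun d =>
    [Kind.W, Kind.P].all fun k =>
      ((C.resA d k).all fun ip => decide (ip.1 < C.family.length)) &&
      ((C.resB d k).all fun ip => decide (ip.1 < C.family.length)) &&
      Resolution.checkL ((C.family.getD d dfltDiagram).peelA k) ((C.resA d k).map (IPiece.toPiece C.family)) &&
      Resolution.checkL ((C.family.getD d dfltDiagram).peelB k) ((C.resB d k).map (IPiece.toPiece C.family))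

/-- Members of a list are `getD`-values at in-range positions. [folklore] -/
theorem mem_iff_getD {α : Type*} (l : List α) (d : α) (x : α) : x ∈ l ↔ ∃ i < l.length, l.getD i d = x := by
  rw [List.mem_iff_getElem]
  constructor
  · rintro ⟨i, hi, rfl⟩; exact ⟨i, hi, by rw [List.getD_eq_getElem?_getD, List.getElem?_eq_getElem hi]; rfl⟩
  · rintro ⟨i, hi, rfl⟩; exact ⟨i, hi, by rw [List.getD_eq_getElem?_getD, List.getElem?_eq_getElem hi]; rfl⟩

/-- **SOUNDNESS OF THE MODE INDUCTION**: a checked closure certificate plus the base cases proves every member of the family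
for every pair of spine shapes (memo g15 §6). [folklore] -/
theorem Cert.sound {q : ℝ} (hq : 0 ≤ q) (top : Top) (C : Cert) (hc : C.check = true)
    (hbase : ∀ D ∈ C.family, DStmt q top D [] []) : ∀ D ∈ C.family, ∀ oA oB : List Kind, DStmt q top D oA oB := by
  -- unpack the check
  have hcheck : ∀ d < C.family.length, ∀ k : Kind,
      (∀ ip ∈ C.resA d k, ip.1 < C.family.length) ∧ (∀ ip ∈ C.resB d k, ip.1 < C.family.length) ∧
      Resolution.checkL ((C.family.getD d dfltDiagram).peelA k) ((C.resA d k).map (IPiece.toPiece C.family)) = true ∧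
      Resolution.checkL ((C.family.getD d dfltDiagram).peelB k) ((C.resB d k).map (IPiece.toPiece C.family)) = true := by
    intro d hd k
    unfold Cert.check at hc
    simp only [List.all_eq_true, List.mem_range, Bool.and_eq_true, decide_eq_true_eq] at hc
    have hk : k ∈ [Kind.W, Kind.P] := by cases k <;> simp
    obtain ⟨⟨⟨h1, h2⟩, h3⟩, h4⟩ := hc d hd k hk
    exact ⟨h1, h2, h3, h4⟩
  have hpieceMem : ∀ (ips : List IPiece), (∀ ip ∈ ips, ip.1 < C.family.length) →
      ∀ pc ∈ ips.map (IPiece.toPiece C.family), pc.P ∈ C.family := by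
    intro ips hips pc hpc
    rw [List.mem_map] at hpc
    obtain ⟨ip, hip, rfl⟩ := hpc
    exact (mem_iff_getD C.family dfltDiagram _).2 ⟨ip.1, hips ip hip, rfl⟩
  -- first: all members, `A = {y}`, every `B`-shape (reverse induction on `oB`)
  have hB : ∀ oB : List Kind, ∀ D ∈ C.family, DStmt q top D [] oB := by
    intro oB
    induction oB using List.reverseRecOn with
    | nil => exact hbase
    | append_singleton oB k ih =>
      intro D hD
      obtain ⟨d, hd, rfl⟩ := (mem_iff_getD C.family dfltDiagram D).1 hD
      obtain ⟨-, hidx, -, hres⟩ := hcheck d hd k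
      exact DStmt.of_peelB (DStmt.of_resolutionL hq hres fun pc hpc => ih pc.P (hpieceMem _ hidx pc hpc))
  -- then: every `A`-shape (reverse induction on `oA`)
  intro D hD oA
  induction oA using List.reverseRecOn generalizing D with
  | nil => exact fun oB => hB oB D hD
  | append_singleton oA k ih =>
    intro oB
    obtain ⟨d, hd, rfl⟩ := (mem_iff_getD C.family dfltDiagram D).1 hD
    obtain ⟨hidx, -, hres, -⟩ := hcheck d hd k
    exact DStmt.of_peelA (DStmt.of_resolutionL hq hres fun pc hpc => ih pc.P (hpieceMem _ hidx pc hpc) oB)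

end TwoSpine

end FK

end Summit.CriticalPhenomena.PercolationContinuityZ3.Theorems

end
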